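import Summits.ABC.IUTFork.Thm311RealInd1StripTwistMoverJW
import HarnessLib

/-!
# [IUTchIII] Thm 3.11 (i) (Ind1) at `v ∈ 𝕍^non`: the twist MOVER read on abc-iut-c312-5's ANALYTIC logarithm

PROOF-ONLY corollary sheet (abc-iut cell, Cor. 3.12 sub-crew, seat abc-iut-c312-1 = holder of record of the typed [IUTchIII]
Thm. 3.11, gen 9; row «R10 IND1-STRIP-MOVER-JW»).  TAKES NO SIDE on [IUTchIII] Cor. 3.12.

My `Real.exists_mem_ind1StripOf_galoisLog_image_closedBall_ne_of_dehnTwists` (`Thm311RealInd1StripTwistMoverJW`) is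
stated over the GALOIS `p_v`-adic logarithm `Real.galoisLog v` ([AbsTopIII] Def. 3.1 (i) `log_k̄` restricted to `𝒪_v^×`).
abc-iut-w5-d216's `Real.galoisLog_eq_analyticLogv` (p452975) identifies it with abc-iut-c312-5's canonical analytic
family `analyticLogv F v` — the binder under which Team R / the C-certificates quantify (`Real.ind1Strip (analyticLogv F) v`,
`Real.logShellsPrint X (analyticLogv F)`).  This sheet records the mover for that binder:
`Real.exists_mem_ind1StripOf_analyticLogv_image_closedBall_ne_of_dehnTwists`.  Conditional on the named fact
`DehnTwistTransvections` (Kondo arXiv:2512.09231 §2 / NSW Thm. 7.5.14) exactly like its parent; a statement about OUR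
typed objects at ONE place; nothing here asserts or refutes [IUTchIII] Cor. 3.12.  [claim: Mochizuki2012, status: disputed];
[cite: Kondo2025OuterAutMLF, §2 Thm 2.1 and proof of Thm 2.3 p.10]; [cite: DupuyHilado2025, §4.7].  typed ≠ proved.
-/

set_option autoImplicit false

noncomputable section

open Metric Set

namespace Summit.ABC.IUTFork.Thm311.Real

open NumberField IsDedekindDomain Literature.NumberTheory.NumberFields Literature.IUT.LogVolume
open Literature.NumberTheory.GaloisRepresentations.Ultrametric Literature.AnabelianGeometry.AbsoluteAnabelian

variable {F : Type} [Field F] [NumberField F] (v : HeightOneSpectrum (𝓞 F))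

/-- **The (Ind1)-strip twist MOVER over the ANALYTIC logarithm**: assuming `DehnTwistTransvections`, at every finite
place `v ∣ p` of `F` with `p` odd, `f(v|p) = 1`, `e(v|p) ≥ 3`, some element `χ` of print's (Ind1) strip part
`Real.ind1StripOf v (analyticLogv F v)` (abc-iut-c312-5's canonical analytic `p`-adic logarithms) and some `m ∈ ℤ` have
`χ(B(0,‖ϖ‖^m)) ≠ B(0,‖ϖ‖^m)` in `K_v` (rescaled norm) — by `Real.galoisLog_eq_analyticLogv` from the Galois-log form.
[claim: Mochizuki2012, status: disputed] [cite: Kondo2025OuterAutMLF, §2 Thm 2.1 and proof of Thm 2.3 p.10] -/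
theorem exists_mem_ind1StripOf_analyticLogv_image_closedBall_ne_of_dehnTwists (hJW : DehnTwistTransvections)
    (p : ℕ) [Fact p.Prime] (hv : ((p : ℕ) : 𝓞 F) ∈ v.asIdeal) (hp2 : p ≠ 2)
    (hf : v.asIdeal.inertiaDeg ℤ = 1) (he : 3 ≤ v.asIdeal.ramificationIdx ℤ)
    {ϖ : (RescaledCompletion F p v hv)ˣ} (hϖ : IsUniformizer ϖ) :
    ∃ χ ∈ ind1StripOf v (analyticLogv F v), ∃ m : ℤ,
      (fun x => RescaledCompletion.of F p v hv (χ ((RescaledCompletion.of F p v hv).symm x))) ''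
          closedBall (0 : RescaledCompletion F p v hv) (‖(ϖ : RescaledCompletion F p v hv)‖ ^ m) ≠
        closedBall (0 : RescaledCompletion F p v hv) (‖(ϖ : RescaledCompletion F p v hv)‖ ^ m) := by
  rw [← galoisLog_eq_analyticLogv]
  exact exists_mem_ind1StripOf_galoisLog_image_closedBall_ne_of_dehnTwists v hJW p hv hp2 hf he hϖ

end Summit.ABC.IUTFork.Thm311.Real

end
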